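import Summits.BirchSwinnertonDyer.BirchSwinnertonDyer.Theorems.SmallImageMuTransferMuTransferX9StepsTwoFourPairTransport
import Summits.BirchSwinnertonDyer.BirchSwinnertonDyer.Theorems.SmallImageMuTransferMuTransferX9StepTwoElement
import HarnessLib

/-!
# Route ByReductionTypeAtTwo, crux `OrdKatoHalfAtTwoIso` (stmt-BirchSwinnertonDyer-19573), line `steinberg-fibre-at-two`,
# registered stub `stub_HK_kolyvaginRankOneTwo` (Ω2 = H-K), interior step M5: PAIR TRANSPORT from a LOCAL Frobenius
# `res r` of `ℚ_q` to the stub's GLOBAL Frobenius `Fr` at `𝔓 ∣ q`, TRANSPOSITION case (`p = 2`)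

Seat `cruxlead-stmt-BirchSwinnertonDyer-19573-g0` (LEAD PROVER, MODE LINE; HOME `run/shared/lean/pub/bsd-2adic/`).
THEOREMS ONLY (no definition, no named fact, no `sorry`). HONEST FRAMING (cell bsd-2adic): BSD is not proved by any of
this; the crux is not proved; this is a `--supports` helper toward the lead's registered research stub
`stub_HK_kolyvaginRankOneTwo : KolyvaginRankOneTwo` (skeleton v5), closing nothing. It transports the
convolution-vanishing `C_i(U(S)·S^m·((g − 1)·Φ(g)), Ψc(g)) = 0` from the local Frobenius `g = res r` of the completion
`ℚ_q` (where the Kolyvagin package and Step 4 deliver it) to the global Frobenius `g = Fr` at any prime `𝔓 ∣ q` (where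
H-K `KolyvaginRankOneTwo`, `Theorems/…OmegaRoadDefs.lean`, concludes it) — the `p = 2` TRANSPOSITION twin of x9's pair
transport `StepsTwoFourTransport.exists_forall_convCoeff_aeval_eq_zero_of_isAbsArithFrob`
(`Theorems/SmallImageMuTransferMuTransferX9StepsTwoFourPairTransport.lean`), whose `E`-split / exact-depth data
(`ρ̄(Fr) = 1`, `Fr ∈ Γ_n ∖ Γ_{n+1}`, ambiguities in `S^{pⁿ}·𝒯_J`) are replaced by the transposition / level data
(`ρ̄₂(Fr²) = 1`, `Fr ∈ Γ_n`, `J ≤ 2ⁿ`: `Fr` acts on `𝒯_J` SLOTWISE through `τ = ρ̄₂(Fr)`, and `N = τ − 1` has `N² = 0`).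

THE MATHEMATICS. `Fr` and `res r` are Frobenii above the same `q`, so there are `t ∈ Γ_ℚ` and `j` in the distinguished
inertia `res(I_{ℚ_q})` with `Fr·t = t·j⁻¹·(res r)` (x9 `exists_forall_isAbsArithFrob_mul_inv_conj_mem_map_absInertia`);
for every cocycle `Θ` vanishing on `res(I_{ℚ_q})` with values fixed by it,
`Θ(Fr) = t·Θ(res r) − ((Fr − 1)·Θ(t))` (x9 `apply_eq_smul_apply_sub_of_mul_inv_conj_mem`) and `Fr ∘ t = t ∘ (res r)`
as operators on `𝒯_J` (§1 `ρ_apply_ρ_inv_apply_eq_of_mul_inv_conj_mem`). With `N := Fr − 1` on `𝒯_J(κ)`, `N² = 0`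
gives `N·Φ(Fr) = t·(N_r·Φ(res r))` EXACTLY (`N_r := res r − 1`), and `Ψc(Fr) = t·Ψc(res r) − N′·Ψc(t)`.  Hence
`C_i(U S^m N Φ(Fr), Ψc(Fr)) = t·C_i(U S^m N_r Φ(res r), Ψc(res r)) − C_i(N·w, N′·Ψc(t))` (equivariance of every
coefficient, x9 `convCoeff_twistModP_smul`; `U(S)`, `S^m` commute with the action), whose first summand vanishes by the
local hypothesis and whose second vanishes TERMWISE: both arguments are slotwise images of `τ − 1`, and
`e((τ − 1)m, (τ − 1)m′) = 0` for an involution `τ` preserving a pairing `e` on a `2`-torsion module (§2; at `p = 2`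
Galois acts trivially on the values `μ₂ ⊂ ℚ` — hypothesis `hP`, discharged by the consumer with
`WeierstrassCurve.mu_two_apply_eq`).  §3 packages the algebra for any `ℤ_p`-extension (`κ.twistModP` currency), §4 is the
statement on `E[2]`, `𝒯_J(E, κ)`, `𝒯_J(E, κ⁻¹)` in the binders of `KolyvaginRankOneTwo`.

References: B. Mazur, K. Rubin, *Kolyvagin systems*, Mem. AMS 799 (2004) Prop. 1.3.2, §1.3 [MazurRubin2004];
L. Washington, *Introduction to Cyclotomic Fields* (1997) §13.1–§13.2 [Washington1997]; J.-P. Serre, *Galois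
Cohomology* (1997) I §5.8 [SerreGaloisCohomology1997]; J.-P. Serre, *Local Fields*, VII §5 [SerreLocalFields1979];
J. Neukirch, *Algebraic Number Theory*, II §9 (9.6) [NeukirchANT1999].
-/

-- the summit and its single problem are both named `BirchSwinnertonDyer` (registry layout D-0017)
set_option linter.dupNamespace false

set_option autoImplicit false

noncomputable section

open scoped NumberField
open Field WeierstrassCurve Literature.NumberTheory.EllipticCurves
  Literature.NumberTheory.GaloisRepresentations Function IsDedekindDomain NumberField Polynomial
open Literature.NumberTheory.GaloisRepresentations.IsNonarchimedeanLocalField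
open Literature.NumberTheory.Automorphic

namespace Summit.BirchSwinnertonDyer.BirchSwinnertonDyer.Rank1Residual.StepsTwoFourTransport

/-! ### §1 Cocycle-free companion of `apply_eq_smul_apply_sub_of_mul_inv_conj_mem`: the intertwining relation -/

section Cocycle

universe u v

variable {R : Type u} [Ring R] [TopologicalSpace R]
variable {G : Type v} [Group G] [TopologicalSpace G]
variable {X : TopRep.{v} R G}

omit [TopologicalSpace G] in
/-- If `ρr·(t·Fr·t⁻¹)⁻¹ ∈ I` with `I` acting trivially on `X`, then `Fr ∘ t⁻¹ = t⁻¹ ∘ ρr` as operators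
on `X` (`Fr·t⁻¹ = t⁻¹·j⁻¹·ρr`, `j = ρr·(t·Fr·t⁻¹)⁻¹`). [cite: SerreLocalFields1979, VII §5] -/
theorem ρ_apply_ρ_inv_apply_eq_of_mul_inv_conj_mem {I : Subgroup G}
    (hIX : ∀ j ∈ I, ∀ x : X, X.ρ j x = x) {t Fr ρr : G} (h : ρr * (t * Fr * t⁻¹)⁻¹ ∈ I) (x : X) :
    X.ρ Fr (X.ρ t⁻¹ x) = X.ρ t⁻¹ (X.ρ ρr x) := by
  have hrel : Fr * t⁻¹ = t⁻¹ * (ρr * (t * Fr * t⁻¹)⁻¹)⁻¹ * ρr := by group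
  rw [← mul_apply_eq_comp, ← map_mul, hrel, map_mul, map_mul, mul_apply_eq_comp, mul_apply_eq_comp,
    hIX _ (I.inv_mem h)]

end Cocycle

/-! ### §2 Pairing algebra: an involution preserving a pairing on a `2`-torsion module -/

section Pairing

variable {M M' P : Type*} [AddCommGroup M] [AddCommGroup M'] [AddCommGroup P]

/-- **`e((τ − 1)m, (τ − 1)m′) = 0`** for a bi-additive pairing `e` on a module killed by `2`, preserved
by an involution `τ` (`e(τm, τm′) = e(m, m′)`, `τ² = 1`): expand and use `e(τm, m′) = e(m, τm′)`.
[cite: MazurRubin2004, Prop. 1.3.2] -/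
theorem pairing_involution_sub_apply_sub_eq_zero (e : M →+ M →+ P) (τ : M →+ M)
    (hτ : ∀ m, τ (τ m) = m) (h2 : ∀ m : M, 2 • m = 0) (he : ∀ m m', e (τ m) (τ m') = e m m')
    (m m' : M) : e (τ m - m) (τ m' - m') = 0 := by
  have h1 : e (τ m) m' = e m (τ m') := by rw [← he m (τ m'), hτ]
  have h0 : ∀ a : M, e a m' + e a m' = 0 := fun a => by
    rw [← AddMonoidHom.add_apply, ← map_add, ← two_nsmul, h2, map_zero, AddMonoidHom.zero_apply]
  simp only [map_sub, AddMonoidHom.sub_apply]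
  rw [he, ← h1]
  calc e m m' - e (τ m) m' - (e (τ m) m' - e m m')
      = (e m m' + e m m') - (e (τ m) m' + e (τ m) m') := by abel
    _ = 0 := by rw [h0, h0, sub_zero]

/-- `C_k` is subtractive in the second argument. [cite: MazurRubin2004, §1.3 and §5.3] -/
theorem convCoeff_sub_right (e : M →+ M' →+ P) (J k : ℕ) (x : Fin J → M) (y y' : Fin J → M') :
    convCoeff e J k x (y - y') = convCoeff e J k x y - convCoeff e J k x y' :=
  map_sub (convCoeffHom e J k x) y y'

/-- **Termwise vanishing**: if `e(f m, f′ m′) = 0` for all `m, m′`, then every convolution coefficient of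
the slotwise images `(f ∘ x, f′ ∘ y)` vanishes. [cite: MazurRubin2004, §1.3 and §5.3] -/
theorem convCoeff_map_eq_zero (e : M →+ M' →+ P) (J k : ℕ) {f : M →+ M} {f' : M' →+ M'}
    (hf : ∀ m m', e (f m) (f' m') = 0) (x : Fin J → M) (y : Fin J → M') :
    convCoeff e J k (fun i => f (x i)) (fun i => f' (y i)) = 0 := by
  rw [convCoeff_map e (g := (0 : P →+ P)) (fun m m' => by rw [hf, AddMonoidHom.zero_apply]) k x y,
    AddMonoidHom.zero_apply]

end Pairing

/-! ### §3 Twist algebra: transport of `C_i(U(S)·S^m·((Fr − 1)·x), y) = 0` along a translate with NILPOTENT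
`(Fr − 1)`-corrections (any `ℤ_p`-extension, `κ.twistModP` currency) -/

section Twist

universe u

variable {K : Type u} [Field K] {p : ℕ} [Fact p.Prime] (κ : ZpExtension K p)
  {M M' P : Type u} [AddCommGroup M] [TopologicalSpace M] [DiscreteTopology M]
  [AddCommGroup M'] [TopologicalSpace M'] [DiscreteTopology M']
  [AddCommGroup P] [TopologicalSpace P] [DiscreteTopology P]
  (ρ : DiscreteGaloisModule K M) (ρ' : DiscreteGaloisModule K M') (ρP : DiscreteGaloisModule K P)
  (hM : ∀ x : M, p • x = 0) (hM' : ∀ x : M', p • x = 0) (J : ℕ)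
  {e : M →+ M' →+ P}
  (he : ∀ (g : absoluteGaloisGroup K) (m : M) (m' : M'), e (ρ g m) (ρ' g m') = ρP g (e m m'))

include he in
/-- **Transport with nilpotent corrections.**  On `𝒯 = 𝒯_J(ρ, κ)`, `𝒯′ = 𝒯_J(ρ′, κ⁻¹)` let `t, Fr, g ∈ Γ_K`
with `Fr ∘ t = t ∘ g` on `𝒯` (`hFrt`), `Fr` acting SLOTWISE on `𝒯` and `𝒯′` (`hFrM`, `hFrM'`) with
`(Fr − 1)² = 0` on `𝒯` (`hN2`) and `e((Fr − 1)m, (Fr − 1)m′) = 0` (`he0`).  If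
`x_Fr = t·x₀ − (Fr − 1)·a` and `y_Fr = t·y₀ − (Fr − 1)·b` (the cocycle identities of `Φ`, `Ψc` at
`Fr = t·j⁻¹·g·t⁻¹`), then `∀ i, i + ε < J → C_i(U(S)·S^m·((g − 1)x₀), y₀) = 0` implies the same for
`(U(S)·S^m·((Fr − 1)x_Fr), y_Fr)`: `(Fr − 1)x_Fr = t·((g − 1)x₀)` exactly, the `t`-translate of a vanishing
coefficient vanishes (equivariance), and the cross term `C_i((Fr − 1)w, (Fr − 1)b)` vanishes termwise.
[cite: MazurRubin2004, Prop. 1.3.2] [cite: Washington1997, §13.1–§13.2] -/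
theorem forall_convCoeff_aeval_frobSub_eq_zero_of_translate {m ε : ℕ} (U : ℤ[X])
    (t Fr g : absoluteGaloisGroup K) {x₀ xFr a : Fin J → M} {y₀ yFr b : Fin J → M'}
    (hx : xFr = κ.twistModP ρ hM J t x₀ - (κ.twistModP ρ hM J Fr a - a))
    (hy : yFr = κ.invTwist.twistModP ρ' hM' J t y₀ - (κ.invTwist.twistModP ρ' hM' J Fr b - b))
    (hFrt : ∀ x, κ.twistModP ρ hM J Fr (κ.twistModP ρ hM J t x) =
      κ.twistModP ρ hM J t (κ.twistModP ρ hM J g x))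
    (hN2 : ∀ x, κ.twistModP ρ hM J Fr (κ.twistModP ρ hM J Fr x - x) - (κ.twistModP ρ hM J Fr x - x) = 0)
    (hFrM : ∀ x : Fin J → M, κ.twistModP ρ hM J Fr x = fun i => ρ Fr (x i))
    (hFrM' : ∀ y : Fin J → M', κ.invTwist.twistModP ρ' hM' J Fr y = fun i => ρ' Fr (y i))
    (he0 : ∀ (m : M) (m' : M'), e (ρ Fr m - m) (ρ' Fr m' - m') = 0)
    (h : ∀ i, i + ε < J → convCoeff e J i
      (aeval (shiftEnd M J) U ((shiftEnd M J ^ m) (κ.twistModP ρ hM J g x₀ - x₀))) y₀ = 0) :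
    ∀ i, i + ε < J → convCoeff e J i
      (aeval (shiftEnd M J) U ((shiftEnd M J ^ m) (κ.twistModP ρ hM J Fr xFr - xFr))) yFr = 0 := by
  intro i hi
  have hi' : i < J := by omega
  subst hx hy
  -- `(Fr − 1)·x_Fr = t·((g − 1)·x₀)` exactly
  have hA : κ.twistModP ρ hM J Fr (κ.twistModP ρ hM J t x₀ - (κ.twistModP ρ hM J Fr a - a)) -
      (κ.twistModP ρ hM J t x₀ - (κ.twistModP ρ hM J Fr a - a)) =
      κ.twistModP ρ hM J t (κ.twistModP ρ hM J g x₀ - x₀) := by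
    rw [map_sub (κ.twistModP ρ hM J Fr), sub_sub_sub_comm, hN2, sub_zero, hFrt,
      ← map_sub (κ.twistModP ρ hM J t)]
  -- the translated first argument is `(Fr − 1)·w`
  have hD : κ.twistModP ρ hM J t
      (aeval (shiftEnd M J) U ((shiftEnd M J ^ m) (κ.twistModP ρ hM J g x₀ - x₀))) =
      κ.twistModP ρ hM J Fr (κ.twistModP ρ hM J t (aeval (shiftEnd M J) U ((shiftEnd M J ^ m) x₀))) -
        κ.twistModP ρ hM J t (aeval (shiftEnd M J) U ((shiftEnd M J ^ m) x₀)) := by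
    rw [map_sub (shiftEnd M J ^ m), map_sub (aeval (shiftEnd M J) U),
      TranslatePairing.shiftEnd_pow_twistModP_apply, aeval_shiftEnd_twistModP_apply,
      map_sub (κ.twistModP ρ hM J t), ← hFrt]
  -- the cross term vanishes termwise
  have key : ∀ (w : Fin J → M) (v : Fin J → M'),
      convCoeff e J i ((fun i => ρ Fr (w i)) - w) ((fun i => ρ' Fr (v i)) - v) = 0 := fun w v =>
    convCoeff_map_eq_zero e J i (f := (ρ Fr).toAddMonoidHom - AddMonoidHom.id M)
      (f' := (ρ' Fr).toAddMonoidHom - AddMonoidHom.id M') he0 w v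
  rw [hA, convCoeff_sub_right, TranslatePairing.shiftEnd_pow_twistModP_apply,
    aeval_shiftEnd_twistModP_apply,
    TranslatePairing.convCoeff_twistModP_smul κ ρ ρ' ρP hM hM' J he hi', h i hi, map_zero, zero_sub,
    neg_eq_zero, hD, hFrM, hFrM']
  exact key _ _

end Twist

/-! ### §4 The pair transport at a transposition prime, `p = 2`, in the binders of `KolyvaginRankOneTwo` -/

section Rat

variable (W : WeierstrassCurve ℚ) (κ : ZpExtension ℚ 2)
  {P : Type} [AddCommGroup P] [TopologicalSpace P] [DiscreteTopology P]
  (ρP : DiscreteGaloisModule ℚ P)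
  {e : geomTorsion W (2 : ℤ) →+ geomTorsion W (2 : ℤ) →+ P}
  (he : ∀ (g : absoluteGaloisGroup ℚ) (m m' : geomTorsion W (2 : ℤ)),
    e (g • m) (g • m') = ρP g (e m m'))
  (hP : ∀ (g : absoluteGaloisGroup ℚ) (z : P), ρP g z = z)

include he hP in
/-- **Pair transport from a local Frobenius to the stub's global Frobenius, transposition case (`p = 2`).**
At a finite place `q ∤ 2` of `ℚ` where `E[2]` is unramified, let `Φ`, `Ψc` be continuous `1`-cocycles of
`𝒯_J(E, κ)`, `𝒯_J(E, κ⁻¹)` vanishing on the restricted local inertia `res(I_{ℚ_q})`, `r` an arithmetic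
Frobenius of `ℚ_q`, `𝔓 ∣ q`, `Fr` an arithmetic Frobenius at `𝔓` with `ρ̄_{E,2}(Fr²) = 1` and
`Fr ∈ Gal(ℚ̄/ℚ_n)`, `J ≤ 2ⁿ`; `e : E[2] × E[2] → P` any `Γ_ℚ`-equivariant pairing with `Γ_ℚ` acting
trivially on `P` (e.g. the Weil pairing into `μ₂ ⊂ ℚ`, `WeierstrassCurve.mu_two_apply_eq`).  If
`∃ U, 2 ∤ U(0) ∧ ∀ i, i + ε < J → C_i(U(S)·S^m·((res r)·Φ(res r) − Φ(res r)), Ψc(res r)) = 0`, then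
`∃ U, 2 ∤ U(0) ∧ ∀ i, i + ε < J → C_i(U(S)·S^m·(Fr·Φ(Fr) − Φ(Fr)), Ψc(Fr)) = 0` (the same `U`).
[cite: MazurRubin2004, Prop. 1.3.2] [cite: Washington1997, §13.1–§13.2]
[cite: SerreGaloisCohomology1997, I §5.8] [cite: NeukirchANT1999, Ch. II §9 Prop. (9.6)] -/
theorem exists_forall_convCoeff_aeval_frobSub_eq_zero_of_isAbsArithFrob {J n m ε : ℕ}
    (hJn : J ≤ 2 ^ n) (Φ : contOneCocycles (W.modPTwist 2 κ J).toTopRep)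
    (Ψc : contOneCocycles (W.modPTwist 2 κ.invTwist J).toTopRep) {q : HeightOneSpectrum (𝓞 ℚ)}
    (hq2 : ((2 : ℕ) : 𝓞 ℚ) ∉ q.asIdeal)
    (hur : GaloisRep.IsUnramifiedAt q (W.torsionGaloisModule (2 : ℤ)))
    (hΦI : ∀ i ∈ absInertia (q.adicCompletion ℚ), Φ.1 (absGaloisRestrict ℚ (q.adicCompletion ℚ) i) = 0)
    (hΨI : ∀ i ∈ absInertia (q.adicCompletion ℚ), Ψc.1 (absGaloisRestrict ℚ (q.adicCompletion ℚ) i) = 0)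
    {r : absoluteGaloisGroup (q.adicCompletion ℚ)} (hr : IsAbsArithFrob r)
    (hloc : ∃ U : ℤ[X], ¬ (2 : ℤ) ∣ U.coeff 0 ∧ ∀ i, i + ε < J →
      convCoeff e J i
        (aeval (shiftEnd (geomTorsion W (2 : ℤ)) J) U
          ((shiftEnd (geomTorsion W (2 : ℤ)) J ^ m)
            (W.modPTwist 2 κ J (absGaloisRestrict ℚ (q.adicCompletion ℚ) r)
                (Φ.1 (absGaloisRestrict ℚ (q.adicCompletion ℚ) r)) -
              Φ.1 (absGaloisRestrict ℚ (q.adicCompletion ℚ) r))))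
        (Ψc.1 (absGaloisRestrict ℚ (q.adicCompletion ℚ) r)) = 0)
    {𝔓 : Ideal (absIntegers (𝓞 ℚ) ℚ)} (h𝔓 : 𝔓 ∈ q.primesAbove) {Fr : absoluteGaloisGroup ℚ}
    (hFr : IsArithFrobAt (𝓞 ℚ) Fr 𝔓) (hT : galoisRepTorsion W 2 (Fr * Fr) = 1)
    (hFrn : Fr ∈ κ.layerSubgroup n) :
    ∃ U : ℤ[X], ¬ (2 : ℤ) ∣ U.coeff 0 ∧ ∀ i, i + ε < J →
      convCoeff e J i
        (aeval (shiftEnd (geomTorsion W (2 : ℤ)) J) U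
          ((shiftEnd (geomTorsion W (2 : ℤ)) J ^ m) (W.modPTwist 2 κ J Fr (Φ.1 Fr) - Φ.1 Fr)))
        (Ψc.1 Fr) = 0 := by
  obtain ⟨U, hU, hvan⟩ := hloc
  -- §1 `res r = j · (t₀ Fr t₀⁻¹)` with `j` in the distinguished inertia
  obtain ⟨t₀, -, ht₀⟩ := exists_forall_isAbsArithFrob_mul_inv_conj_mem_map_absInertia h𝔓 hFr
  have hj := ht₀ r hr
  have hIX : ∀ j ∈ (absInertia (q.adicCompletion ℚ)).map
      (absGaloisRestrict ℚ (q.adicCompletion ℚ)).toMonoidHom,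
      ∀ x : (W.modPTwist 2 κ J).toTopRep, (W.modPTwist 2 κ J).toTopRep.ρ j x = x := by
    rintro j ⟨i, hi, rfl⟩ x
    exact toTopRep_ρ_absGaloisRestrict_apply_eq_self_of_mem_absInertia W 2 κ hq2 hur hi x
  have hIY : ∀ j ∈ (absInertia (q.adicCompletion ℚ)).map
      (absGaloisRestrict ℚ (q.adicCompletion ℚ)).toMonoidHom,
      ∀ y : (W.modPTwist 2 κ.invTwist J).toTopRep,
        (W.modPTwist 2 κ.invTwist J).toTopRep.ρ j y = y := by
    rintro j ⟨i, hi, rfl⟩ y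
    exact toTopRep_ρ_absGaloisRestrict_apply_eq_self_of_mem_absInertia W 2 κ.invTwist hq2 hur hi y
  have hΦ0 : ∀ j ∈ (absInertia (q.adicCompletion ℚ)).map
      (absGaloisRestrict ℚ (q.adicCompletion ℚ)).toMonoidHom, Φ.1 j = 0 := by
    rintro j ⟨i, hi, rfl⟩
    exact hΦI i hi
  have hΨ0 : ∀ j ∈ (absInertia (q.adicCompletion ℚ)).map
      (absGaloisRestrict ℚ (q.adicCompletion ℚ)).toMonoidHom, Ψc.1 j = 0 := by
    rintro j ⟨i, hi, rfl⟩
    exact hΨI i hi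
  -- the cocycle identities and the intertwining relation, ONE `t = t₀⁻¹` for both cocycles
  have hΦ := apply_eq_smul_apply_sub_of_mul_inv_conj_mem Φ hIX hΦ0 hj
  have hΨ := apply_eq_smul_apply_sub_of_mul_inv_conj_mem Ψc hIY hΨ0 hj
  have hFrt := fun x => ρ_apply_ρ_inv_apply_eq_of_mul_inv_conj_mem hIX hj x
  -- `Fr` acts slotwise on `𝒯_J(κ)`, `𝒯_J(κ⁻¹)` (`J ≤ 2ⁿ`, `Fr ∈ Γ_n`)
  have hFrM : ∀ x : Fin J → geomTorsion W (2 : ℤ), W.modPTwist 2 κ J Fr x = fun i => Fr • x i :=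
    fun x => modPTwist_apply_of_mem_layerSubgroup_of_le W 2 κ hJn hFrn x
  have hFrM' : ∀ y : Fin J → geomTorsion W (2 : ℤ),
      W.modPTwist 2 κ.invTwist J Fr y = fun i => Fr • y i :=
    fun y => modPTwist_apply_of_mem_layerSubgroup_of_le W 2 κ.invTwist hJn
      ((ZpExtension.layerSubgroup_invTwist κ n).symm ▸ hFrn) y
  -- `τ² = 1` on `E[2]`, `2·E[2] = 0`
  have hτ : ∀ Q : geomTorsion W (2 : ℤ), Fr • Fr • Q = Q := fun Q => by
    rw [← mul_smul]
    exact forall_smul_eq_of_galoisRepTorsion_eq_one W 2 hT Q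
  have h2 : ∀ Q : geomTorsion W (2 : ℤ), 2 • Q = 0 := fun Q => AddSubgroup.torsionBy.nsmul Q
  -- `(Fr − 1)² = 0` on `𝒯_J(κ)`
  have hN2 : ∀ x : Fin J → geomTorsion W (2 : ℤ),
      W.modPTwist 2 κ J Fr (W.modPTwist 2 κ J Fr x - x) - (W.modPTwist 2 κ J Fr x - x) = 0 := by
    intro x
    have hFF : W.modPTwist 2 κ J Fr (W.modPTwist 2 κ J Fr x) = x := by
      rw [hFrM, hFrM]
      exact funext fun i => hτ (x i)
    have h2X : (x - W.modPTwist 2 κ J Fr x) + (x - W.modPTwist 2 κ J Fr x) = 0 := by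
      rw [← two_nsmul]
      exact funext fun i => h2 _
    rw [map_sub, hFF]
    calc x - W.modPTwist 2 κ J Fr x - (W.modPTwist 2 κ J Fr x - x)
        = (x - W.modPTwist 2 κ J Fr x) + (x - W.modPTwist 2 κ J Fr x) := by abel
      _ = 0 := h2X
  -- (β): `e((τ − 1)m, (τ − 1)m′) = 0`
  have he0 : ∀ m m' : geomTorsion W (2 : ℤ), e (Fr • m - m) (Fr • m' - m') = 0 := fun m m' =>
    pairing_involution_sub_apply_sub_eq_zero e (DistribSMul.toAddMonoidHom (geomTorsion W (2 : ℤ)) Fr)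
      hτ h2 (fun a b => by rw [DistribSMul.toAddMonoidHom_apply, DistribSMul.toAddMonoidHom_apply, he, hP])
      m m'
  -- transport
  exact ⟨U, hU, forall_convCoeff_aeval_frobSub_eq_zero_of_translate κ (W.torsionGaloisModule (2 : ℤ))
    (W.torsionGaloisModule (2 : ℤ)) ρP (fun Q => AddSubgroup.torsionBy.nsmul Q)
    (fun Q => AddSubgroup.torsionBy.nsmul Q) J
    (fun g a b => by rw [torsionGaloisModule_apply_apply, torsionGaloisModule_apply_apply, he]) U t₀⁻¹ Fr
    (absGaloisRestrict ℚ (q.adicCompletion ℚ) r)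
    (x₀ := Φ.1 (absGaloisRestrict ℚ (q.adicCompletion ℚ) r)) (xFr := Φ.1 Fr) (a := Φ.1 t₀⁻¹)
    (y₀ := Ψc.1 (absGaloisRestrict ℚ (q.adicCompletion ℚ) r)) (yFr := Ψc.1 Fr) (b := Ψc.1 t₀⁻¹)
    hΦ hΨ hFrt hN2 hFrM hFrM' he0 hvan⟩

end Rat

end Summit.BirchSwinnertonDyer.BirchSwinnertonDyer.Rank1Residual.StepsTwoFourTransport

end
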